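import Mathlib
import HarnessLib
import Summits.ABC.ABC.Statement
import Summits.ABC.ABC.Theorems.SoloBlindOmega3Prelude

/-!
# Linear pencils `x^l` vs `2^n`, part 1: the trivial regimes, large `l` (Matveev), and `l ∣ n`

`Summits/ABC/ABC/Theorems/SoloBlindLinearPencilMatveev.lean`; namespace `Summit.ABC.ABC.Theorems`
(solo seat `solo-ABC-blind`, wall coordinate T55, part 1 of 3; assembled in `SoloBlindLinearPencils`).

Fix an odd `x` and exponents `l, n` with `x^l ≠ 2^n`; put `b = |2^n − x^l| ≥ 1`, `M = max(2^n, x^l)`.  The target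
inequality of T55 is `M < C(ε) · (x·b)^{1+ε}`.  This file proves it, with EXPLICIT constants,
* in the TRIVIAL regimes `2x^l ≤ 2^n` or `2·2^n ≤ x^l` (`M ≤ 2b`; `linearPencil_trivial`);
* for LARGE `l ≥ L₀(ε)` granting Matveev's theorem for two logarithms (the tree's named fact
  `matveev2000_linearFormsLog_rat` [Matveev2000], via `matveev_two_nat` of `SoloBlindOmega3Prelude`): in the main
  regime the linear form `Λ = n log 2 − l log x = log(2^n/x^l) ≠ 0` has `|Λ|·M ≤ 2b` (`log u ≤ u − 1`), and Matveev
  with `B = l + 1` gives `|Λ| > x^{−A(1+log(l+1))}`, `A = 2³² log 2`; in log-space this yields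
  `log M < (1+ε) log 2 + (1+ε) log(xb)` as soon as `(1+ε)·A·(1+log(l+1)) ≤ ε·l`, which holds for
  `l ≥ L₀ = ⌈16K² + 2K + 2⌉`, `K = (1+ε)A/ε` (`log(l+1) ≤ 2√(l+1)`; `linearPencil_threshold`, `linearPencil_large`);
* when `l ∣ n`, `n = lt` (`b = |(2^t)^l − x^l| ≥ |2^t − x|·x^{l−1} ≥ x^{l−1}`, so `xb ≥ x^l > M/2`;
  `linearPencil_divisible`).
The remaining case `0 < n mod l < l < L₀` is Ridout's (`SoloBlindLinearPencilRidout`).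

Tools: `abs_sub_mul_pow_le` (`|u − v|·v^k ≤ |u^{k+1} − v^{k+1}|`), `one_le_abs_natCast_sub`, `two_rpow_div_pow`,
`isAlgebraic_two_rpow_div` (`2^{m/l}` is a root of `X^l − 2^m`), `eq_zero_of_odd_pow_eq_two_pow`,
`linearPencil_main_basic`.  Trust base: the Matveev named fact as a hypothesis where it occurs; everything else
is proved. [this project]

## References

* [Matveev2000] E. M. Matveev, *An explicit lower bound for a homogeneous rational linear form in logarithms of
  algebraic numbers. II*, Izv. Math. 64 (2000) 1217–1269 (as printed in Evertse–Győry 2015, Thm. 3.2.4).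
-/

noncomputable section

namespace Summit.ABC.ABC.Theorems

open Real Literature.NumberTheory.DiophantineGeometry Literature.NumberTheory.DiophantineGeometry.Dioph

/-! ## Elementary tools -/

/-- `|u − v| · v^k ≤ |u^{k+1} − v^{k+1}|` for `u, v ≥ 0`. [folklore] -/
theorem abs_sub_mul_pow_le {u v : ℝ} (hu : 0 ≤ u) (hv : 0 ≤ v) (k : ℕ) :
    |u - v| * v ^ k ≤ |u ^ (k + 1) - v ^ (k + 1)| := by
  rcases le_total v u with h | h
  · have h1 : v ^ k ≤ u ^ k := pow_le_pow_left₀ hv h k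
    have h2 : v ^ (k + 1) ≤ u ^ (k + 1) := pow_le_pow_left₀ hv h (k + 1)
    rw [abs_of_nonneg (sub_nonneg.mpr h), abs_of_nonneg (sub_nonneg.mpr h2)]
    have h3 : 0 ≤ u * (u ^ k - v ^ k) := mul_nonneg hu (sub_nonneg.mpr h1)
    calc (u - v) * v ^ k = u ^ (k + 1) - v ^ (k + 1) - u * (u ^ k - v ^ k) := by ring
      _ ≤ u ^ (k + 1) - v ^ (k + 1) := by linarith
  · have h1 : u ^ k ≤ v ^ k := pow_le_pow_left₀ hu h k
    have h2 : u ^ (k + 1) ≤ v ^ (k + 1) := pow_le_pow_left₀ hu h (k + 1)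
    rw [abs_of_nonpos (sub_nonpos.mpr h), abs_of_nonpos (sub_nonpos.mpr h2)]
    have h3 : 0 ≤ u * (v ^ k - u ^ k) := mul_nonneg hu (sub_nonneg.mpr h1)
    calc -(u - v) * v ^ k = -(u ^ (k + 1) - v ^ (k + 1)) - u * (v ^ k - u ^ k) := by ring
      _ ≤ -(u ^ (k + 1) - v ^ (k + 1)) := by linarith

/-- Distinct naturals differ by at least `1` (as reals). [folklore] -/
theorem one_le_abs_natCast_sub {A B : ℕ} (h : A ≠ B) : (1 : ℝ) ≤ |(A : ℝ) - (B : ℝ)| := by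
  rcases Nat.lt_or_gt_of_ne h with hlt | hgt
  · have : (A : ℝ) + 1 ≤ B := by exact_mod_cast hlt
    rw [abs_of_nonpos (by linarith)]; linarith
  · have : (B : ℝ) + 1 ≤ A := by exact_mod_cast hgt
    rw [abs_of_nonneg (by linarith)]; linarith

/-- `(2^{m/l})^l = 2^m` for `l ≥ 1`. [folklore] -/
theorem two_rpow_div_pow (m l : ℕ) (hl : 0 < l) :
    ((2 : ℝ) ^ ((m : ℝ) / (l : ℝ))) ^ l = (2 : ℝ) ^ m := by
  have hl' : (l : ℝ) ≠ 0 := by exact_mod_cast hl.ne'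
  rw [← Real.rpow_natCast, ← Real.rpow_mul (by norm_num)]
  have : (m : ℝ) / (l : ℝ) * (l : ℝ) = (m : ℝ) := by field_simp
  rw [this, Real.rpow_natCast]

/-- `2^{m/l}` is algebraic over `ℚ` (a root of `X^l − 2^m`). [folklore] -/
theorem isAlgebraic_two_rpow_div (m l : ℕ) (hl : 0 < l) :
    IsAlgebraic ℚ ((2 : ℝ) ^ ((m : ℝ) / (l : ℝ))) := by
  refine ⟨Polynomial.X ^ l - Polynomial.C ((2 : ℚ) ^ m), Polynomial.X_pow_sub_C_ne_zero hl _, ?_⟩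
  have h := two_rpow_div_pow m l hl
  simp [h]

/-- An odd power is never a positive power of two: `x` odd, `x^l = 2^n ⟹ n = 0`. [folklore] -/
theorem eq_zero_of_odd_pow_eq_two_pow {x l n : ℕ} (hx : Odd x) (h : x ^ l = 2 ^ n) : n = 0 := by
  by_contra hn
  have h2 : Odd (2 ^ n) := by rw [← h]; exact hx.pow
  exact (Nat.not_even_iff_odd.mpr h2) ((Nat.even_pow' hn).mpr even_two)

/-! ## The trivial regimes -/

/-- TRIVIAL regimes: if `2x^l ≤ 2^n` or `2·2^n ≤ x^l` then `max(2^n, x^l) ≤ 2|2^n − x^l|`, so the target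
inequality holds with any constant `C > 2`. [this project] -/
theorem linearPencil_trivial {x l n : ℕ} {ε C : ℝ} (hε : 0 < ε) (hC : 2 < C) (hx : 1 ≤ x)
    (hne : x ^ l ≠ 2 ^ n) (h : 2 * x ^ l ≤ 2 ^ n ∨ 2 * 2 ^ n ≤ x ^ l) :
    max ((2 : ℝ) ^ n) ((x : ℝ) ^ l) < C * ((x : ℝ) * |(2 : ℝ) ^ n - (x : ℝ) ^ l|) ^ (1 + ε) := by
  have hb1 : (1 : ℝ) ≤ |(2 : ℝ) ^ n - (x : ℝ) ^ l| := by
    have := one_le_abs_natCast_sub (Ne.symm hne)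
    push_cast at this
    exact this
  have hx1 : (1 : ℝ) ≤ x := by exact_mod_cast hx
  have hP0 : (0 : ℝ) ≤ (x : ℝ) ^ l := by positivity
  have hT0 : (0 : ℝ) ≤ (2 : ℝ) ^ n := by positivity
  have hxb1 : (1 : ℝ) ≤ (x : ℝ) * |(2 : ℝ) ^ n - (x : ℝ) ^ l| := by nlinarith
  have hxb_le : (x : ℝ) * |(2 : ℝ) ^ n - (x : ℝ) ^ l| ≤
      ((x : ℝ) * |(2 : ℝ) ^ n - (x : ℝ) ^ l|) ^ (1 + ε) :=
    Real.self_le_rpow_of_one_le hxb1 (by linarith)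
  have hb_le : |(2 : ℝ) ^ n - (x : ℝ) ^ l| ≤ (x : ℝ) * |(2 : ℝ) ^ n - (x : ℝ) ^ l| :=
    le_mul_of_one_le_left (abs_nonneg _) hx1
  have hY0 : (0 : ℝ) < ((x : ℝ) * |(2 : ℝ) ^ n - (x : ℝ) ^ l|) ^ (1 + ε) :=
    Real.rpow_pos_of_pos (by linarith) _
  have hM2b : max ((2 : ℝ) ^ n) ((x : ℝ) ^ l) ≤ 2 * |(2 : ℝ) ^ n - (x : ℝ) ^ l| := by
    rcases h with h1 | h2
    · have h1R : 2 * (x : ℝ) ^ l ≤ (2 : ℝ) ^ n := by exact_mod_cast h1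
      rw [max_eq_left (by linarith), abs_of_nonneg (by linarith)]
      linarith
    · have h2R : 2 * (2 : ℝ) ^ n ≤ (x : ℝ) ^ l := by exact_mod_cast h2
      rw [max_eq_right (by linarith), abs_sub_comm, abs_of_nonneg (by linarith)]
      linarith
  calc max ((2 : ℝ) ^ n) ((x : ℝ) ^ l) ≤ 2 * ((x : ℝ) * |(2 : ℝ) ^ n - (x : ℝ) ^ l|) ^ (1 + ε) := by
        linarith [hb_le.trans hxb_le]
    _ < C * ((x : ℝ) * |(2 : ℝ) ^ n - (x : ℝ) ^ l|) ^ (1 + ε) := mul_lt_mul_of_pos_right hC hY0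

/-- In the MAIN regime (`2^n < 2x^l`, `x^l < 2·2^n`) with `x` odd and `x^l ≠ 2^n`: `x ≥ 3` and `n ≠ 0`.
[folklore] -/
theorem linearPencil_main_basic {x l n : ℕ} (hx : Odd x) (hne : x ^ l ≠ 2 ^ n)
    (hA1 : 2 ^ n < 2 * x ^ l) (hA2 : x ^ l < 2 * 2 ^ n) : 3 ≤ x ∧ n ≠ 0 ∧ l ≠ 0 := by
  obtain ⟨k, hk⟩ := id hx
  have hn : n ≠ 0 := by
    rintro rfl
    have h1 : x ^ l < 2 := by simpa using hA2
    have h2 : 1 ≤ x ^ l := Nat.one_le_pow _ _ hx.pos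
    have : x ^ l = 1 := by omega
    exact hne (by simpa using this)
  have hl : l ≠ 0 := by
    rintro rfl
    have h1 : 2 ^ n < 2 := by simpa using hA1
    have h2 : 2 ≤ 2 ^ n := Nat.one_lt_two_pow hn
    omega
  refine ⟨?_, hn, hl⟩
  by_contra hx3
  have hx1 : x = 1 := by omega
  subst hx1
  have h1 : 2 ^ n < 2 := by simpa using hA1
  have h2 : 2 ≤ 2 ^ n := Nat.one_lt_two_pow hn
  omega

/-! ## Large `l`: Matveev -/

/-- The threshold: for `l ≥ ⌈16K² + 2K + 2⌉`, `K = (1+ε)A/ε`, one has `(1+ε)·A·(1 + log(l+1)) ≤ ε·l`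
(`A > 0`).  [folklore] -/
theorem linearPencil_threshold {A ε : ℝ} (hA : 0 < A) (hε : 0 < ε) {l : ℕ}
    (hl : ⌈16 * ((1 + ε) * A / ε) ^ 2 + 2 * ((1 + ε) * A / ε) + 2⌉₊ ≤ l) :
    (1 + ε) * A * (1 + Real.log ((l : ℝ) + 1)) ≤ ε * l ∧ 1 ≤ l := by
  set K : ℝ := (1 + ε) * A / ε with hK
  have hK0 : 0 < K := by positivity
  have hlR : 16 * K ^ 2 + 2 * K + 2 ≤ (l : ℝ) := (Nat.le_ceil _).trans (by exact_mod_cast hl)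
  have hl0 : (0 : ℝ) ≤ l := by positivity
  have hl1 : (1 : ℝ) ≤ l := by nlinarith [sq_nonneg K]
  refine ⟨?_, by exact_mod_cast hl1⟩
  set S : ℝ := ((l : ℝ) + 1) ^ ((1 : ℝ) / 2) with hSdef
  have hS0 : 0 ≤ S := Real.rpow_nonneg (by positivity) _
  have hS2 : S ^ 2 = (l : ℝ) + 1 := by
    rw [hSdef, ← Real.rpow_natCast, ← Real.rpow_mul (by positivity)]
    norm_num
  have hlogS : Real.log ((l : ℝ) + 1) ≤ 2 * S := by
    have h := Real.log_le_rpow_div (x := (l : ℝ) + 1) (ε := 1 / 2) (by positivity) (by norm_num)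
    rw [← hSdef] at h
    have : S / (1 / 2) = 2 * S := by ring
    linarith
  have h4KS : 4 * K * S ≤ l := by
    have h1 : (4 * K * S) ^ 2 ≤ (l : ℝ) ^ 2 := by
      have : (4 * K * S) ^ 2 = 16 * K ^ 2 * ((l : ℝ) + 1) := by rw [← hS2]; ring
      rw [this]
      nlinarith [mul_nonneg (sub_nonneg.mpr hlR) hl0, sq_nonneg K, mul_nonneg hK0.le hl0]
    exact (pow_le_pow_iff_left₀ (by positivity) hl0 two_ne_zero).mp h1
  have h2K : 2 * K ≤ l := by nlinarith [sq_nonneg K]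
  have hKε : (1 + ε) * A = ε * K := by rw [hK]; field_simp
  have hlog0 : 0 ≤ Real.log ((l : ℝ) + 1) := Real.log_nonneg (by linarith)
  calc (1 + ε) * A * (1 + Real.log ((l : ℝ) + 1)) ≤ (1 + ε) * A * (1 + 2 * S) := by
        apply mul_le_mul_of_nonneg_left _ (by positivity); linarith
    _ = ε * (K + 2 * K * S) := by rw [hKε]; ring
    _ ≤ ε * l := by apply mul_le_mul_of_nonneg_left _ hε.le; linarith

/-- **Large `l` (Matveev).**  Granting `matveev2000_linearFormsLog_rat`: for `l ≥ L₀(ε)` and every odd `x`, `n`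
with `x^l ≠ 2^n`, `max(2^n, x^l) < (2^{1+ε} + 1)·(x·|2^n − x^l|)^{1+ε}`.  Fully explicit. [this project] -/
theorem linearPencil_large (hM : matveev2000_linearFormsLog_rat) {ε : ℝ} (hε : 0 < ε) :
    ∃ L₀ : ℕ, ∀ x l n : ℕ, Odd x → L₀ ≤ l → x ^ l ≠ 2 ^ n →
      max ((2 : ℝ) ^ n) ((x : ℝ) ^ l) <
        ((2 : ℝ) ^ (1 + ε) + 1) * ((x : ℝ) * |(2 : ℝ) ^ n - (x : ℝ) ^ l|) ^ (1 + ε) := by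
  set A : ℝ := 2 ^ 32 * Real.log 2 with hA
  have hlog2 : 0 < Real.log 2 := Real.log_pos one_lt_two
  have hA0 : 0 < A := by positivity
  refine ⟨⌈16 * ((1 + ε) * A / ε) ^ 2 + 2 * ((1 + ε) * A / ε) + 2⌉₊, ?_⟩
  intro x l n hxodd hl hne
  obtain ⟨hthr, hl1⟩ := linearPencil_threshold hA0 hε hl
  have hx1 : 1 ≤ x := hxodd.pos
  have h2C : (2 : ℝ) < (2 : ℝ) ^ (1 + ε) + 1 := by
    have : (1 : ℝ) < (2 : ℝ) ^ (1 + ε) := Real.one_lt_rpow one_lt_two (by linarith)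
    linarith
  by_cases htriv : 2 * x ^ l ≤ 2 ^ n ∨ 2 * 2 ^ n ≤ x ^ l
  · exact linearPencil_trivial hε h2C hx1 hne htriv
  push Not at htriv
  obtain ⟨hA1, hA2⟩ := htriv
  obtain ⟨hx3, hn0, -⟩ := linearPencil_main_basic hxodd hne hA1 hA2
  -- real-number facts
  have hX : (3 : ℝ) ≤ x := by exact_mod_cast hx3
  have hX0 : (0 : ℝ) < x := by linarith
  have hP0 : (0 : ℝ) < (x : ℝ) ^ l := pow_pos hX0 l
  have hT0 : (0 : ℝ) < (2 : ℝ) ^ n := by positivity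
  have hA1R : (2 : ℝ) ^ n < 2 * (x : ℝ) ^ l := by exact_mod_cast hA1
  have hA2R : (x : ℝ) ^ l < 2 * (2 : ℝ) ^ n := by exact_mod_cast hA2
  have hneR : (x : ℝ) ^ l ≠ (2 : ℝ) ^ n := by exact_mod_cast hne
  have hlogx : Real.log 2 ≤ Real.log x := Real.log_le_log two_pos (by linarith)
  have hlogx0 : 0 < Real.log x := by linarith
  -- the linear form `Λ = log(2^n / x^l) = -l log x + n log 2`
  set Λ : ℝ := Real.log ((2 : ℝ) ^ n / (x : ℝ) ^ l) with hΛdef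
  have hΛeq : ((-(l : ℤ) : ℤ) : ℝ) * Real.log x + ((n : ℤ) : ℝ) * Real.log ((2 : ℕ) : ℝ) = Λ := by
    rw [hΛdef, Real.log_div hT0.ne' hP0.ne', Real.log_pow, Real.log_pow]
    push_cast
    ring
  have hΛne : Λ ≠ 0 := by
    rw [hΛdef]
    apply Real.log_ne_zero_of_pos_of_ne_one (div_pos hT0 hP0)
    intro h
    rw [div_eq_one_iff_eq hP0.ne'] at h
    exact hneR h.symm
  -- Matveev with `B = l + 1`
  have key : -(2 ^ 32 * (Real.log x * Real.log 2) * (1 + Real.log ((l : ℝ) + 1))) < Real.log |Λ| := by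
    have hB1 : (1 : ℝ) ≤ (l : ℝ) + 1 := by linarith
    have hb1 : |((-(l : ℤ) : ℤ) : ℝ)| ≤ (l : ℝ) + 1 := by
      push_cast
      rw [abs_neg, Nat.abs_cast]
      linarith
    have hb2 : |((n : ℤ) : ℝ)| * Real.log ((2 : ℕ) : ℝ) ≤ ((l : ℝ) + 1) * Real.log x := by
      push_cast
      rw [Nat.abs_cast]
      have h2 : Real.log ((2 : ℝ) ^ n) < Real.log (2 * (x : ℝ) ^ l) := Real.log_lt_log hT0 hA1R
      rw [Real.log_mul two_ne_zero hP0.ne', Real.log_pow, Real.log_pow] at h2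
      have hn0' : (0 : ℝ) ≤ n := by positivity
      nlinarith
    have hne2 : (n : ℤ) ≠ 0 := by exact_mod_cast hn0
    have hΛ' : ((-(l : ℤ) : ℤ) : ℝ) * Real.log x + ((n : ℤ) : ℝ) * Real.log ((2 : ℕ) : ℝ) ≠ 0 := by
      rw [hΛeq]; exact hΛne
    have k := matveev_two_nat hM (x := x) (y := 2) (by omega) le_rfl hne2 hΛ' hB1 hb1 hb2
    rw [hΛeq] at k
    have h22 : Real.log ((2 : ℕ) : ℝ) = Real.log 2 := by norm_num
    rw [h22] at k
    exact k
  have hii : -(A * (1 + Real.log ((l : ℝ) + 1)) * Real.log x) < Real.log |Λ| := by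
    have : A * (1 + Real.log ((l : ℝ) + 1)) * Real.log x =
        2 ^ 32 * (Real.log x * Real.log 2) * (1 + Real.log ((l : ℝ) + 1)) := by rw [hA]; ring
    rw [this]; exact key
  -- `M`, `b` and `|Λ| · M ≤ 2 b`
  set T : ℝ := (2 : ℝ) ^ n with hTdef
  set P : ℝ := (x : ℝ) ^ l with hPdef
  have hb0 : 0 < |T - P| := abs_pos.mpr (sub_ne_zero.mpr (Ne.symm hneR))
  have hMP : P ≤ max T P := le_max_right _ _
  have hM0 : 0 < max T P := lt_of_lt_of_le hP0 hMP
  have hi : |Λ| * max T P ≤ 2 * |T - P| := by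
    rcases lt_or_gt_of_ne hneR with hlt | hgt
    · -- `P < T`
      have hMT : max T P = T := max_eq_left hlt.le
      have hΛpos : 0 < Λ := by rw [hΛdef]; exact Real.log_pos ((one_lt_div hP0).mpr hlt)
      have hΛle : Λ ≤ T / P - 1 := by rw [hΛdef]; exact Real.log_le_sub_one_of_pos (div_pos hT0 hP0)
      rw [abs_of_pos hΛpos, hMT, abs_of_pos (by linarith : 0 < T - P)]
      have h1 : Λ * P ≤ T - P := by
        have := mul_le_mul_of_nonneg_right hΛle hP0.le
        rwa [sub_mul, div_mul_cancel₀ _ hP0.ne', one_mul] at this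
      nlinarith [mul_pos hΛpos (by linarith : (0 : ℝ) < 2 * P - T)]
    · -- `T < P`
      have hMT : max T P = P := max_eq_right hgt.le
      have hΛneg : Λ < 0 := by rw [hΛdef]; exact Real.log_neg (div_pos hT0 hP0) ((div_lt_one hP0).mpr hgt)
      have hle : -Λ ≤ P / T - 1 := by
        rw [hΛdef, ← Real.log_inv, inv_div]
        exact Real.log_le_sub_one_of_pos (div_pos hP0 hT0)
      rw [abs_of_neg hΛneg, hMT, abs_sub_comm, abs_of_pos (by linarith : 0 < P - T)]
      have h1 : -Λ * T ≤ P - T := by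
        have := mul_le_mul_of_nonneg_right hle hT0.le
        rwa [sub_mul, div_mul_cancel₀ _ hT0.ne', one_mul] at this
      nlinarith [mul_pos (neg_pos.mpr hΛneg) (by linarith : (0 : ℝ) < 2 * T - P)]
  -- log-space bookkeeping
  have hLM : (l : ℝ) * Real.log x ≤ Real.log (max T P) := by
    rw [← Real.log_pow]; exact Real.log_le_log hP0 hMP
  have hf1 : Real.log |Λ| + Real.log (max T P) ≤ Real.log 2 + Real.log |T - P| := by
    rw [← Real.log_mul (abs_pos.mpr hΛne).ne' hM0.ne', ← Real.log_mul two_ne_zero hb0.ne']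
    exact Real.log_le_log (mul_pos (abs_pos.mpr hΛne) hM0) hi
  have hE0 : 0 ≤ A * (1 + Real.log ((l : ℝ) + 1)) := by
    have : 0 ≤ Real.log ((l : ℝ) + 1) := Real.log_nonneg (by linarith)
    positivity
  have hgoal : Real.log (max T P) <
      (1 + ε) * Real.log 2 + (1 + ε) * (Real.log x + Real.log |T - P|) := by
    have g1 : (1 + ε) * (Real.log |Λ| + Real.log (max T P)) ≤
        (1 + ε) * (Real.log 2 + Real.log |T - P|) := mul_le_mul_of_nonneg_left hf1 (by linarith)
    have g2 : (1 + ε) * (-(A * (1 + Real.log ((l : ℝ) + 1)) * Real.log x)) <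
        (1 + ε) * Real.log |Λ| := mul_lt_mul_of_pos_left hii (by linarith)
    have g3 : (1 + ε) * (A * (1 + Real.log ((l : ℝ) + 1))) * Real.log x ≤ ε * l * Real.log x := by
      have := mul_le_mul_of_nonneg_right hthr hlogx0.le
      linarith
    have g4 : ε * ((l : ℝ) * Real.log x) ≤ ε * Real.log (max T P) :=
      mul_le_mul_of_nonneg_left hLM hε.le
    have g5 : 0 ≤ (1 + ε) * Real.log x := by positivity
    linarith [g1, g2, g3, g4, g5]
  -- exponentiate
  have hxb0 : 0 < (x : ℝ) * |T - P| := mul_pos hX0 hb0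
  have hpos : 0 < ((x : ℝ) * |T - P|) ^ (1 + ε) := Real.rpow_pos_of_pos hxb0 _
  have hrhs : Real.log ((2 : ℝ) ^ (1 + ε) * ((x : ℝ) * |T - P|) ^ (1 + ε)) =
      (1 + ε) * Real.log 2 + (1 + ε) * (Real.log x + Real.log |T - P|) := by
    rw [Real.log_mul (by positivity) hpos.ne', Real.log_rpow two_pos, Real.log_rpow hxb0,
      Real.log_mul hX0.ne' hb0.ne']
  have hlt : max T P < (2 : ℝ) ^ (1 + ε) * ((x : ℝ) * |T - P|) ^ (1 + ε) := by
    rw [← Real.log_lt_log_iff hM0 (mul_pos (by positivity) hpos), hrhs]; exact hgoal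
  linarith [hlt, hpos]

/-! ## Small `l`, `l ∣ n`: elementary -/

/-- If `l ∣ n` (`n = l·t`), `l ≥ 1`, `x` odd, `x^l ≠ 2^n`: `max(2^n, x^l) < 3·(x·|2^n − x^l|)^{1+ε}`
(`|(2^t)^l − x^l| ≥ |2^t − x|·x^{l−1} ≥ x^{l−1}`). [this project] -/
theorem linearPencil_divisible {x l t : ℕ} {ε : ℝ} (hε : 0 < ε) (hxodd : Odd x) (hl : 1 ≤ l)
    (hne : x ^ l ≠ 2 ^ (l * t)) :
    max ((2 : ℝ) ^ (l * t)) ((x : ℝ) ^ l) < 3 * ((x : ℝ) * |(2 : ℝ) ^ (l * t) - (x : ℝ) ^ l|) ^ (1 + ε) := by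
  have hx1 : 1 ≤ x := hxodd.pos
  by_cases htriv : 2 * x ^ l ≤ 2 ^ (l * t) ∨ 2 * 2 ^ (l * t) ≤ x ^ l
  · exact linearPencil_trivial hε (by norm_num) hx1 hne htriv
  push Not at htriv
  obtain ⟨hA1, hA2⟩ := htriv
  obtain ⟨hx3, -, -⟩ := linearPencil_main_basic hxodd hne hA1 hA2
  have hX : (3 : ℝ) ≤ x := by exact_mod_cast hx3
  have hX0 : (0 : ℝ) < x := by linarith
  have hP0 : (0 : ℝ) < (x : ℝ) ^ l := pow_pos hX0 l
  have hA1R : (2 : ℝ) ^ (l * t) < 2 * (x : ℝ) ^ l := by exact_mod_cast hA1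
  -- `2^t ≠ x`
  have h2tx : 2 ^ t ≠ x := by
    intro h
    apply hne
    rw [← h, ← pow_mul, Nat.mul_comm l t]
  have h1 : (1 : ℝ) ≤ |((2 : ℝ) ^ t) - (x : ℝ)| := by
    have := one_le_abs_natCast_sub h2tx
    push_cast at this
    exact this
  -- `x^{l-1} ≤ |2^t − x| x^{l−1} ≤ |2^{lt} − x^l|`
  have hgeom : |(2 : ℝ) ^ t - x| * (x : ℝ) ^ (l - 1) ≤ |(2 : ℝ) ^ (l * t) - (x : ℝ) ^ l| := by
    have h := abs_sub_mul_pow_le (by positivity : (0 : ℝ) ≤ (2 : ℝ) ^ t) hX0.le (l - 1)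
    rw [show l - 1 + 1 = l by omega, ← pow_mul, Nat.mul_comm t l] at h
    exact h
  have hxb : (x : ℝ) ^ l ≤ (x : ℝ) * |(2 : ℝ) ^ (l * t) - (x : ℝ) ^ l| := by
    have h2 : (x : ℝ) ^ (l - 1) ≤ |(2 : ℝ) ^ (l * t) - (x : ℝ) ^ l| := by
      have h3 : (x : ℝ) ^ (l - 1) ≤ |(2 : ℝ) ^ t - x| * (x : ℝ) ^ (l - 1) :=
        le_mul_of_one_le_left (by positivity) h1
      exact h3.trans hgeom
    calc (x : ℝ) ^ l = (x : ℝ) * (x : ℝ) ^ (l - 1) := by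
          rw [← pow_succ', show l - 1 + 1 = l by omega]
      _ ≤ (x : ℝ) * |(2 : ℝ) ^ (l * t) - (x : ℝ) ^ l| := mul_le_mul_of_nonneg_left h2 hX0.le
  have hxb1 : (1 : ℝ) ≤ (x : ℝ) * |(2 : ℝ) ^ (l * t) - (x : ℝ) ^ l| := by
    have : (1 : ℝ) ≤ (x : ℝ) ^ l := one_le_pow₀ (by linarith)
    linarith
  have hY : (x : ℝ) * |(2 : ℝ) ^ (l * t) - (x : ℝ) ^ l| ≤
      ((x : ℝ) * |(2 : ℝ) ^ (l * t) - (x : ℝ) ^ l|) ^ (1 + ε) :=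
    Real.self_le_rpow_of_one_le hxb1 (by linarith)
  have hM : max ((2 : ℝ) ^ (l * t)) ((x : ℝ) ^ l) < 2 * (x : ℝ) ^ l := max_lt hA1R (by linarith)
  linarith [hxb.trans hY]


end Summit.ABC.ABC.Theorems
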